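import Mathlib
import Summits.ValiantsHypothesis.ValiantsHypothesis.Statement
import Summits.ValiantsHypothesis.ValiantsHypothesis.Theorems.SoloInformedPolynomialWindow
import HarnessLib

/-!
# Homogeneous polynomial sections of degree at most `max_i |S_i|` suffice
# (solo seat `solo-ValiantsHypothesis-informed`, s30)

Continuation of `SoloInformedPolynomialWindow`.  If `y_1, …, y_s ∈ ℂ[x_1, …, x_n]` realise the set
family `S` in their quadratic span, so do their `s (D + 1)` homogeneous components of degree `≤ D`,
`D = max_i |S_i|` (`SoloPolyRealisedFamily.homogenize`: take the degree-`|S_i|` component of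
`x^{S_i} = ∑ λ y_j y_k`).  Running the window theorem at the order function `s ↦ Kf (2 s²)` (still
polylogarithmic) absorbs the factor `D + 1 ≤ n + 1 ≤ 2 s^{1/c₀}`:

* `soloInformed_valiantsHypothesis_of_homPolyWindowBound_fewVars` (monotone `Kf`), log order
  `…_of_homPolyLogOrderBound_fewVars`, fixed order `…_of_homPolyFixedOrderBound_fewVars` — it
  suffices, for `ValiantsHypothesis`, to bound by `C · s^γ` (`γ < 3/2`) the size of set families on
  `n ≤ s^{1/c₀}` points, independent to order `Kf s`, realised by `s` HOMOGENEOUS polynomials of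
  degree `≤ max_i |S_i|`.

Only the implications are claimed; the hypotheses are OPEN (seat notes `paper/quadspan.md` §2.10).

References: R. Raz, Elusive functions and lower bounds for arithmetic circuits, Theory of
Computing 6 (2010) 135–177, Cor. 5.8 [Raz2010].
-/

noncomputable section

open MvPolynomial Finset

namespace Summit.ValiantsHypothesis.ValiantsHypothesis.Theorems

open Literature.Computability.AlgebraicComplexity

/-! ### Homogeneous sections of degree at most `max_i |S_i|` suffice -/

/-- The largest target size `max_i |S_i|` of a set family (`0` for the empty family). -/
def soloMaxCard {m n : ℕ} (S : Fin m → Finset (Fin n)) : ℕ :=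
  Finset.univ.sup fun i => (S i).card

/-- `max_i |S_i| ≤ n`. [folklore] -/
theorem soloMaxCard_le {m n : ℕ} (S : Fin m → Finset (Fin n)) : soloMaxCard S ≤ n :=
  Finset.sup_le fun i _ => (Finset.card_le_univ (S i)).trans (by rw [Fintype.card_fin])

/-- `|S_i| ≤ max_i |S_i|`. [folklore] -/
theorem card_le_soloMaxCard {m n : ℕ} (S : Fin m → Finset (Fin n)) (i : Fin m) :
    (S i).card ≤ soloMaxCard S :=
  Finset.le_sup (f := fun i => (S i).card) (Finset.mem_univ i)

/-- The target monomial `x^{S_i}` is a form of degree `|S_i|`. -/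
theorem soloDesignMap_isHomogeneous {m n : ℕ} (S : Fin m → Finset (Fin n)) (i : Fin m) :
    (soloDesignMap S i).IsHomogeneous (S i).card := by
  have h := IsHomogeneous.prod (S i) (fun r => (X r : MvPolynomial (Fin n) ℂ)) (fun _ => 1)
    (fun r _ => isHomogeneous_X ℂ r)
  simpa [soloDesignMap] using h

/-- **Homogeneous normalisation.**  If `s` polynomials realise `S`, then so do the
`s · (max_i |S_i| + 1)` homogeneous components of degree `≤ max_i |S_i|` of those polynomials:
taking the degree-`|S_i|` component of `x^{S_i} = ∑ λ_{jk} y_j y_k` gives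
`x^{S_i} = ∑ λ_{jk} ∑_{e + e' = |S_i|} (y_j)_e (y_k)_{e'}`. [folklore] -/
theorem SoloPolyRealisedFamily.homogenize {s m n : ℕ} {y : Fin s → MvPolynomial (Fin n) ℂ}
    {S : Fin m → Finset (Fin n)} (h : SoloPolyRealisedFamily y S) :
    ∃ (e : Fin (s * (soloMaxCard S + 1)) → ℕ)
      (y' : Fin (s * (soloMaxCard S + 1)) → MvPolynomial (Fin n) ℂ),
      (∀ j, e j ≤ soloMaxCard S) ∧ (∀ j, (y' j).IsHomogeneous (e j)) ∧
        SoloPolyRealisedFamily y' S := by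
  classical
  refine ⟨fun j => ((finProdFinEquiv.symm j).2 : ℕ),
    fun j => homogeneousComponent ((finProdFinEquiv.symm j).2 : ℕ) (y (finProdFinEquiv.symm j).1),
    fun j => Nat.lt_succ_iff.mp (finProdFinEquiv.symm j).2.isLt,
    fun j => homogeneousComponent_isHomogeneous _ _, fun i => ?_⟩
  have hd : (S i).card ≤ soloMaxCard S := card_le_soloMaxCard S i
  rw [← homogeneousComponent_eq_self (soloDesignMap_isHomogeneous S i)]
  have hmem := Submodule.mem_map_of_mem (f := homogeneousComponent (S i).card) (h i)
  rw [Submodule.map_span] at hmem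
  refine (Submodule.span_le.mpr ?_) hmem
  rintro _ ⟨_, ⟨p, rfl⟩, rfl⟩
  change homogeneousComponent (S i).card (y p.1 * y p.2) ∈ _
  rw [DepthReduction.homogeneousComponent_mul]
  refine Submodule.sum_mem _ fun k hk => ?_
  have hk' : k ≤ (S i).card := Nat.lt_succ_iff.mp (Finset.mem_range.mp hk)
  refine Submodule.subset_span
    ⟨(finProdFinEquiv (p.1, ⟨k, by omega⟩), finProdFinEquiv (p.2, ⟨(S i).card - k, by omega⟩)), ?_⟩
  simp only [Equiv.symm_apply_apply]

/-- `⌊log₂ (2 s²)⌋ ≤ 2 ⌊log₂ s⌋ + 2`. -/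
theorem solo_log_two_mul_sq_le (s : ℕ) (hs : 1 ≤ s) :
    Nat.log 2 (2 * s ^ 2) ≤ 2 * Nat.log 2 s + 2 := by
  have h1 : s < 2 ^ (Nat.log 2 s + 1) := Nat.lt_pow_succ_log_self one_lt_two s
  have h2 : 2 * s ^ 2 < 2 ^ (2 * Nat.log 2 s + 3) := by
    calc 2 * s ^ 2 < 2 * (2 ^ (Nat.log 2 s + 1)) ^ 2 :=
          Nat.mul_lt_mul_of_pos_left (Nat.pow_lt_pow_left h1 two_ne_zero) two_pos
      _ = 2 ^ (2 * Nat.log 2 s + 3) := by ring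
  have h3 : Nat.log 2 (2 * s ^ 2) < 2 * Nat.log 2 s + 3 :=
    Nat.log_lt_of_lt_pow (by positivity) h2
  omega

/-- **Homogeneous polynomial sections of degree `≤ max_i |S_i|` on few variables ⟹ Valiant's
hypothesis (window form).**  Let `Kf` be a monotone order function with `Kf s ≤ (⌊log₂ s⌋ + 2)^C`
eventually, and fix any `c₀`.  Suppose that for some real `γ < 3/2` and `C'`, for all large `s`:
every set family `S_1, …, S_m ⊂ Fin n` with `n^{c₀} ≤ s`, independent to order `Kf s`, whose
monomials `x^{S_i}` all lie in the span of the pairwise products of `s` HOMOGENEOUS polynomials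
`y_1, …, y_s ∈ ℂ[x_1, …, x_n]` of degrees `≤ max_i |S_i|`, has `m ≤ C' · s^γ`.  Then `VP ℂ ≠ VNP ℂ`.
(From `soloInformed_valiantsHypothesis_of_polyWindowBound_fewVars`, run with the order function
`s ↦ Kf (2 s²)`, by homogeneous normalisation: `s` arbitrary sections become
`s (max_i |S_i| + 1) ≤ 2 s² ∧ ≤ 2 s^{1 + 1/c₀'}` homogeneous ones, for a suitable `c₀' ≥ c₀`.)  The
hypothesis is OPEN; only the implication is claimed.
[cite: Raz2010, Cor. 5.8 (p. 172), Prop. 2.7 (pp. 152–153)] -/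
theorem soloInformed_valiantsHypothesis_of_homPolyWindowBound_fewVars (Kf : ℕ → ℕ)
    (hmono : Monotone Kf) {Cexp s₁ : ℕ} (hKf : ∀ s, s₁ ≤ s → Kf s ≤ (Nat.log 2 s + 2) ^ Cexp)
    (c₀ : ℕ) {γ C : ℝ} (hγ : γ < 3 / 2) {s₀ : ℕ}
    (hQ : ∀ s : ℕ, s₀ ≤ s → ∀ (n m : ℕ) (S : Fin m → Finset (Fin n)), n ^ c₀ ≤ s →
      SoloIndep (Kf s) S → ∀ (e : Fin s → ℕ) (y : Fin s → MvPolynomial (Fin n) ℂ),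
        (∀ j, e j ≤ soloMaxCard S) → (∀ j, (y j).IsHomogeneous (e j)) →
        SoloPolyRealisedFamily y S → (m : ℝ) ≤ C * (s : ℝ) ^ γ) :
    ValiantsHypothesis := by
  -- exponents: `γ' = max γ 0`, `c₁ ≥ max c₀ 1` with `γ' (1 + 1/c₁) < 3/2`
  set γ' := max γ 0 with hγ'
  have hγ'0 : 0 ≤ γ' := le_max_right _ _
  have hγ'lt : γ' < 3 / 2 := max_lt hγ (by norm_num)
  have hpos : 0 < 3 - 2 * γ' := by linarith
  obtain ⟨c₂, hc₂⟩ := exists_nat_gt (2 * γ' / (3 - 2 * γ'))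
  set c₁ := max (max c₂ c₀) 1 with hc₁
  have hc₁1 : 1 ≤ c₁ := le_max_right _ _
  have hc₁0 : c₀ ≤ c₁ := (le_max_right _ _).trans (le_max_left _ _)
  have hc₁r : (0 : ℝ) < c₁ := by exact_mod_cast hc₁1
  have hc₂c₁ : (c₂ : ℝ) ≤ c₁ := by exact_mod_cast (le_max_left _ _).trans (le_max_left _ _)
  have hγ'' : γ' + γ' / c₁ < 3 / 2 := by
    have h1 : 2 * γ' < c₁ * (3 - 2 * γ') := by
      have := (div_lt_iff₀ hpos).1 (hc₂.trans_le hc₂c₁)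
      linarith
    have h2 : γ' / c₁ < (3 - 2 * γ') / 2 := by
      rw [div_lt_iff₀ hc₁r]; linarith
    linarith
  set C' := max C 0 with hC'
  have hC'0 : 0 ≤ C' := le_max_right _ _
  -- the order function `s ↦ Kf (2 s²)` is still polylogarithmic
  have hKf' : ∀ s, max s₁ 1 ≤ s → Kf (2 * s ^ 2) ≤ (Nat.log 2 s + 2) ^ (2 * Cexp) := by
    intro s hs
    have hs1 : 1 ≤ s := (le_max_right _ _).trans hs
    have hs₁ : s₁ ≤ 2 * s ^ 2 :=
      ((le_max_left _ _).trans hs).trans (by nlinarith)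
    calc Kf (2 * s ^ 2) ≤ (Nat.log 2 (2 * s ^ 2) + 2) ^ Cexp := hKf _ hs₁
      _ ≤ (2 * (Nat.log 2 s + 2)) ^ Cexp :=
          Nat.pow_le_pow_left (by have := solo_log_two_mul_sq_le s hs1; omega) _
      _ = 2 ^ Cexp * (Nat.log 2 s + 2) ^ Cexp := mul_pow _ _ _
      _ ≤ (Nat.log 2 s + 2) ^ Cexp * (Nat.log 2 s + 2) ^ Cexp :=
          Nat.mul_le_mul_right _ (Nat.pow_le_pow_left (by omega) _)
      _ = (Nat.log 2 s + 2) ^ (2 * Cexp) := by rw [two_mul, pow_add]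
  refine soloInformed_valiantsHypothesis_of_polyWindowBound_fewVars (fun s => Kf (2 * s ^ 2))
    (Cexp := 2 * Cexp) (s₁ := max s₁ 1) hKf' c₁
    (γ := γ' + γ' / c₁) (C := C' * (2 : ℝ) ^ γ') hγ'' (s₀ := max s₀ 1)
    fun s hs n m S hn hind y hreal => ?_
  have hs1 : 1 ≤ s := (le_max_right _ _).trans hs
  have hs1r : (1 : ℝ) ≤ s := by exact_mod_cast hs1
  have hs0r : (0 : ℝ) < s := by positivity
  -- homogenise: `s' = s (D + 1)` homogeneous sections of degree `≤ D = max |S_i| ≤ n ≤ s`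
  obtain ⟨e, y', he, hy', hreal'⟩ := hreal.homogenize
  have hDn : (soloMaxCard S) ≤ n := soloMaxCard_le S
  have hns : n ≤ s := by
    rcases Nat.eq_zero_or_pos n with hn0 | hnpos
    · omega
    · exact (Nat.le_self_pow (by omega) n |>.trans (Nat.pow_le_pow_right hnpos hc₁1)).trans
        ((Nat.pow_le_pow_right hnpos le_rfl).trans hn)
  have hss' : s ≤ s * ((soloMaxCard S) + 1) := Nat.le_mul_of_pos_right _ (Nat.succ_pos _)
  have hs'2 : s * ((soloMaxCard S) + 1) ≤ 2 * s ^ 2 := by nlinarith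
  have hnc₀ : n ^ c₀ ≤ s * ((soloMaxCard S) + 1) := by
    rcases Nat.eq_zero_or_pos n with hn0 | hnpos
    · subst hn0
      calc 0 ^ c₀ ≤ 1 := by rcases Nat.eq_zero_or_pos c₀ with h | h <;> simp [h]
        _ ≤ s * ((soloMaxCard S) + 1) := hs1.trans hss'
    · exact ((Nat.pow_le_pow_right hnpos hc₁0).trans hn).trans hss'
  have hind' : SoloIndep (Kf (s * ((soloMaxCard S) + 1))) S := hind.mono (hmono hs'2)
  have hm : (m : ℝ) ≤ C * ((s * ((soloMaxCard S) + 1) : ℕ) : ℝ) ^ γ :=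
    hQ (s * ((soloMaxCard S) + 1)) (((le_max_left _ _).trans hs).trans hss') n m S hnc₀ hind' e y'
      he hy' hreal'
  -- arithmetic: `s (max |S_i| + 1) ≤ 2 s^{1 + 1/c₁}`
  have hs'1 : (1 : ℝ) ≤ ((s * ((soloMaxCard S) + 1) : ℕ) : ℝ) := by exact_mod_cast hs1.trans hss'
  have hnr : (n : ℝ) ≤ (s : ℝ) ^ ((1 : ℝ) / c₁) := by
    have h1 : ((n : ℝ) ^ (c₁ : ℝ)) ≤ s := by
      rw [Real.rpow_natCast]; exact_mod_cast hn
    calc (n : ℝ) = ((n : ℝ) ^ (c₁ : ℝ)) ^ ((1 : ℝ) / c₁) := by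
          rw [← Real.rpow_mul (Nat.cast_nonneg n), mul_one_div_cancel hc₁r.ne', Real.rpow_one]
      _ ≤ (s : ℝ) ^ ((1 : ℝ) / c₁) := Real.rpow_le_rpow (by positivity) h1 (by positivity)
  have hsc : (1 : ℝ) ≤ (s : ℝ) ^ ((1 : ℝ) / c₁) := Real.one_le_rpow hs1r (by positivity)
  have hs'le : ((s * ((soloMaxCard S) + 1) : ℕ) : ℝ) ≤ 2 * (s : ℝ) ^ (1 + (1 : ℝ) / c₁) := by
    have hD1 : (((soloMaxCard S) + 1 : ℕ) : ℝ) ≤ 2 * (s : ℝ) ^ ((1 : ℝ) / c₁) := by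
      have : ((soloMaxCard S) : ℝ) ≤ n := by exact_mod_cast hDn
      push_cast; linarith
    calc ((s * ((soloMaxCard S) + 1) : ℕ) : ℝ)
        = (s : ℝ) * (((soloMaxCard S) + 1 : ℕ) : ℝ) := by push_cast; ring
      _ ≤ (s : ℝ) * (2 * (s : ℝ) ^ ((1 : ℝ) / c₁)) := mul_le_mul_of_nonneg_left hD1 hs0r.le
      _ = 2 * (s : ℝ) ^ (1 + (1 : ℝ) / c₁) := by
          rw [Real.rpow_add hs0r, Real.rpow_one]; ring
  calc (m : ℝ) ≤ C * ((s * ((soloMaxCard S) + 1) : ℕ) : ℝ) ^ γ := hm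
    _ ≤ C' * ((s * ((soloMaxCard S) + 1) : ℕ) : ℝ) ^ γ :=
        mul_le_mul_of_nonneg_right (le_max_left _ _) (by positivity)
    _ ≤ C' * ((s * ((soloMaxCard S) + 1) : ℕ) : ℝ) ^ γ' :=
        mul_le_mul_of_nonneg_left (Real.rpow_le_rpow_of_exponent_le hs'1 (le_max_left _ _)) hC'0
    _ ≤ C' * (2 * (s : ℝ) ^ (1 + (1 : ℝ) / c₁)) ^ γ' :=
        mul_le_mul_of_nonneg_left (Real.rpow_le_rpow (by positivity) hs'le hγ'0) hC'0
    _ = C' * (2 : ℝ) ^ γ' * (s : ℝ) ^ (γ' + γ' / c₁) := by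
        rw [Real.mul_rpow (by norm_num) (by positivity), ← Real.rpow_mul hs0r.le]
        rw [show (1 + (1 : ℝ) / c₁) * γ' = γ' + γ' / c₁ by ring]
        ring

/-- **(VB-log-hpoly on few variables) ⟹ Valiant's hypothesis.**  For any fixed `c₀`: if for some
real `γ < 3/2` and `C`, for all large `s`, every set family `S_1, …, S_m ⊂ Fin n` with `n^{c₀} ≤ s`,
independent to order `⌊log₂ s⌋ + 2`, whose monomials `x^{S_i}` all lie in the span of the pairwise
products of `s` HOMOGENEOUS polynomials of `ℂ[x_1, …, x_n]` of degrees `≤ max_i |S_i|`, has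
`m ≤ C · s^γ`, then `VP ℂ ≠ VNP ℂ`.  This is the weakest hypothesis certified by this seat to decide
the summit. [cite: Raz2010, Cor. 5.8 (p. 172), Prop. 2.7 (pp. 152–153)] -/
theorem soloInformed_valiantsHypothesis_of_homPolyLogOrderBound_fewVars (c₀ : ℕ) {γ C : ℝ}
    (hγ : γ < 3 / 2) {s₀ : ℕ}
    (hQ : ∀ s : ℕ, s₀ ≤ s → ∀ (n m : ℕ) (S : Fin m → Finset (Fin n)), n ^ c₀ ≤ s →
      SoloIndep (Nat.log 2 s + 2) S → ∀ (e : Fin s → ℕ) (y : Fin s → MvPolynomial (Fin n) ℂ),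
        (∀ j, e j ≤ soloMaxCard S) → (∀ j, (y j).IsHomogeneous (e j)) →
        SoloPolyRealisedFamily y S → (m : ℝ) ≤ C * (s : ℝ) ^ γ) :
    ValiantsHypothesis :=
  soloInformed_valiantsHypothesis_of_homPolyWindowBound_fewVars (fun s => Nat.log 2 s + 2)
    (fun a b h => Nat.add_le_add_right (Nat.log_mono_right h) 2) (Cexp := 1) (s₁ := 0)
    (fun s _ => by rw [pow_one]) c₀ hγ hQ

/-- **Homogeneous polynomial sections, fixed order, few variables ⟹ Valiant's hypothesis.**  Fix
any `K` and `c₀`.  Suppose that for some real `γ < 3/2` and `C`, for all large `s`: every set family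
`S_1, …, S_m ⊂ Fin n` with `n^{c₀} ≤ s`, independent to order `K`, whose monomials `x^{S_i}` all lie
in the span of the pairwise products of `s` HOMOGENEOUS polynomials `y_1, …, y_s ∈ ℂ[x_1, …, x_n]`
of degrees `≤ max_i |S_i|`, has `m ≤ C · s^γ`.  Then `VP ℂ ≠ VNP ℂ`.  The hypothesis is OPEN (and
false for `K ≤ 5`); only the implication is claimed.
[cite: Raz2010, Cor. 5.8 (p. 172), Prop. 2.7 (pp. 152–153)] -/
theorem soloInformed_valiantsHypothesis_of_homPolyFixedOrderBound_fewVars (K c₀ : ℕ) {γ C : ℝ}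
    (hγ : γ < 3 / 2) {s₀ : ℕ}
    (hQ : ∀ s : ℕ, s₀ ≤ s → ∀ (n m : ℕ) (S : Fin m → Finset (Fin n)), n ^ c₀ ≤ s →
      SoloIndep K S → ∀ (e : Fin s → ℕ) (y : Fin s → MvPolynomial (Fin n) ℂ),
        (∀ j, e j ≤ soloMaxCard S) → (∀ j, (y j).IsHomogeneous (e j)) →
        SoloPolyRealisedFamily y S → (m : ℝ) ≤ C * (s : ℝ) ^ γ) :
    ValiantsHypothesis := by
  refine soloInformed_valiantsHypothesis_of_homPolyWindowBound_fewVars (fun _ => K) monotone_const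
    (Cexp := K) (s₁ := 0) (fun s _ => ?_) c₀ hγ hQ
  calc K ≤ 2 ^ K := Nat.lt_two_pow_self.le
    _ ≤ (Nat.log 2 s + 2) ^ K := Nat.pow_le_pow_left (by omega) K

end Summit.ValiantsHypothesis.ValiantsHypothesis.Theorems

end
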